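/- Copyright: ym3-torus cell, WIDTH-5 ATTACH seat `ym-ust-19936-w4` (prover, g11), for crux `HistoryTailL` (stmt-QuantumFields-19936),
line «local_insertion»: the PREFACTOR-FREE bounded-height tail of the block-averaged plaquette (route-independent input of the stub file).
Released under the licence of the surrounding project. -/
import Summits.QuantumFields.YangMills.Theorems.UnitScaleTiltHistoryTailBoundedHeightLocal
import Summits.QuantumFields.YangMills.Theorems.LocalInsertionExpMomentSU2TorusUniformT3
import Summits.QuantumFields.YangMills.Theorems.LocalInsertionSublevelDoublingOneSitePartition
import Summits.QuantumFields.YangMills.Theorems.LocalInsertionWindowTailOfConcentration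
import HarnessLib

/-!
# Line «local_insertion» on crux `HistoryTailL` (stmt-QuantumFields-19936) — THE PREFACTOR-FREE BOUNDED-HEIGHT TAIL OF THE BLOCK-AVERAGED
# PLAQUETTE: crude transport (footprint covering) × the level-0 UNIFORM tail; window form = a Gaussian tail at the natural scale `g_{K−j}`

Cell `ym3-torus` (YM ladder rung R3 = continuum SU(2) Yang–Mills on the three-torus — a RUNG, NOT the Clay problem: not d = 4, not
infinite volume, not a mass gap), width seat `ym-ust-19936-w4` gen 11, `--supports stmt-QuantumFields-19936 --as helper`.  THEOREMS ONLY,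
definition-free, ROUTE-INDEPENDENT imports (no `Theses` cone): this is the input file of `Theorems/LocalInsertionStubHeightOne.lean`, which
turns §2 into the registered stub `stub_insertionHeightOne` through ★w3 g11's door.

THE LOCATED FACT.  The tree's bounded-height per-plaquette certificate ✓`HistoryTailBoundedHeightLocal.perPlaquette_boundedHeight_uniform`
(ym-ust-19936-w2 g8) carries a `β_{K−j}^5` prefactor, inherited from the small-Haar-ball chessboard bound `T3FinestHeightTail.gibbsMeasure_real_dist1_ge_le`
(`(√β)⁹`).  The level-0 lane of this line (T1–T4: ★w7 g9–g10, ★w4 g10; closed 2026-08-29T03:00Z — the (T4-SUB) one-site doubling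
✓`SublevelDoubling.oneSite_partitionFunction_doubling_su2_d3` discharging the last hypothesis of ✓`ExpMomentSU2UniformT3.exists_gibbsK_real_dist1_ge_le_uniform`,
= ✓`LevelZeroUniformSU2T3.exists_gibbsK_real_dist1_ge_le`) REMOVED that prefactor: `Gibbs_K{θ ≤ |U(∂q) − 1|} ≤ e^{A}·e^{−β_Kθ²∕8}` for every fine
plaquette, every `θ ≥ 0`, once `β_K ≥ 8`.  Feeding it — instead of the small-ball bound — into the SAME footprint covering
✓`HistoryTailBoundedHeightLocal.gibbsK_real_event_le_sum_footprint` (the LOCAL crude Prop. 1 of [Balaban1985Averaging] iterated `j` times: a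
large averaged plaquette forces a fine plaquette of its footprint, `#T ≤ (81L³)^j`, to exceed `θ∕(151L²)^j`) gives

* §1 ★★`gibbsK_real_dist1_iter_ge_le_uniform : ∃ A, ∀ F γ, 0 < γ ≤ 1∕8 → ∀ K j, j ≤ K → ∀ θ ≥ 0, ∀ p,
      Gibbs_K{θ ≤ |Ū^{j}(∂p) − 1|} ≤ (81L³)^j · e^{A} · exp(−β_K·θ²∕(8·((151L²)^j)²))` — PREFACTOR-FREE, volume-free, `K`-free;
* §2 ★★`gibbsK_real_window_ge_le_uniform` — window letters (`θ = t·g_{K−j}`, `β_K·g_{K−j}² = L^j`, ✓`WindowTailOfConcentration.beta_mul_coupling_sq`):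
  `Gibbs_K{t·g_{K−j} ≤ |Ū^{j}(∂a) − 1|} ≤ (81L³)^j e^{A}·exp(−t²·L^j∕(8·((151L²)^j)²))`, GAUSSIAN in `t` at the natural scale with constants `(L, j)` only;
  `gauss_le_linExp` (completing the square: a Gaussian tail is linear-exponential with any rate).

WHY THIS DOES NOT TOUCH THE ORGAN.  The constants degrade like `(81L³)^j` and `(151L²)^{2j}·L^{−j}` with the height — at BOUNDED height a
constant, which is all the first rung `stub_insertionHeightOne` needs; the `j`-UNIFORM statement («averaging is smoothing», the number to beat
`L^{3j}`; LEAD census v1.19 (c)) is untouched and remains the content of `stub_insertionHigher` ∕ `LocalInsertionL` (stmt-23607).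

HONEST FRAMING.  Elementary over tree theorems (union bound over a footprint + the level-0 uniform tail).  Nothing of the stubs, `LocalInsertionL`,
the crux `HistoryTailL`, K1, NODE O, d = 4, a continuum limit or a mass gap is proved here.  YM₃ on T³ is rung R3, NOT the Clay problem.

References: T. Bałaban, CMP **98** (1985) 17–51 [Balaban1985Averaging] (Prop. 1 (51) p.26); CMP **102** (1985) 255–275 [Balaban1985UV3]
((3) p.256, (7) p.257, (71) p.273); S. Chatterjee, CMP 2016 [Chatterjee2016] (the free-energy sandwich behind the level-0 uniform tail).
-/

set_option autoImplicit false

noncomputable section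

open scoped BigOperators
open MeasureTheory
open Literature.MathematicalPhysics.QuantumFieldTheory
open Literature.MathematicalPhysics.QuantumFieldTheory.Balaban1983to89
open Literature.MathematicalPhysics.QuantumFieldTheory.Balaban1983to89.T3ContinuumYM3Torus
open Literature.MathematicalPhysics.QuantumFieldTheory.Balaban1983to89.T3UnitScaleTilt
open Literature.MathematicalPhysics.QuantumFieldTheory.Balaban1983to89.T3UnitLawDensityEML
open Literature.MathematicalPhysics.QuantumFieldTheory.Balaban1983to89.T3UpperLiftSplit (scheme_β_eq)
open Literature.MathematicalPhysics.QuantumFieldTheory.Balaban1983to89.T4PairDerivBridge (dist1_le_two_specialUnitaryGroup)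
open Summit.QuantumFields.YangMills.Theorems.HistoryTailBoundedHeight (lam_pos)
open Summit.QuantumFields.YangMills.Theorems.HistoryTailBoundedHeightLocal (gibbsK_real_event_le_sum_footprint)
open Literature.MathematicalPhysics.QuantumLattice (fundamentalRep)
open Summit.QuantumFields.YangMills.Theorems.LocalInsertion.ExpMomentSU2UniformT3 (exists_gibbsK_real_dist1_ge_le_uniform)
open Summit.QuantumFields.YangMills.Theorems.LocalInsertion.SublevelDoubling (oneSite_partitionFunction_doubling_su2_d3)
open Summit.QuantumFields.YangMills.Theorems.LocalInsertion.WindowTailOfConcentration (beta_mul_coupling_sq)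

namespace Summit.QuantumFields.YangMills.Theorems.LocalInsertion.BoundedHeightTailUniform

/-! ## §1 The prefactor-free bounded-height tail of the block-averaged plaquette -/

/-- `β_K = (γL^{−K})⁻¹ ≥ 8` once `0 < γ ≤ 1∕8` (`L ≥ 1`). [cite: Balaban1985UV3, (3) p.256] -/
theorem eight_le_scheme_β (F : T3Family) {γ : ℝ} (hγ : 0 < γ) (hγ8 : γ ≤ 1 / 8) (K : ℕ) : 8 ≤ (F.scheme ℰp γ).β K := by
  have hL1 : (1 : ℝ) ≤ F.L := by exact_mod_cast F.hL.2.le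
  have hx0 : 0 < γ * ((F.L : ℝ)⁻¹) ^ K := by positivity
  have hxγ : γ * ((F.L : ℝ)⁻¹) ^ K ≤ γ := by
    have h1 : ((F.L : ℝ)⁻¹) ^ K ≤ 1 := pow_le_one₀ (by positivity) (inv_le_one_of_one_le₀ hL1)
    calc γ * ((F.L : ℝ)⁻¹) ^ K ≤ γ * 1 := mul_le_mul_of_nonneg_left h1 hγ.le
      _ = γ := mul_one _
  rw [scheme_β_eq]
  exact le_inv_of_le_inv₀ hx0 (by linarith)

/-- **THE PREFACTOR-FREE BOUNDED-HEIGHT TAIL.**  There is an absolute `A` such that for every family `F`, every `0 < γ ≤ 1∕8`, every cut-off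
`K`, every height `j ≤ K`, every `θ ≥ 0` and every plaquette `p` of `T^{(j)}`:
`Gibbs_K{θ ≤ |Ū^{j}(∂p) − 1|} ≤ (81L³)^j · e^{A} · exp(−β_K·θ²∕(8·((151L²)^j)²))`.  The footprint covering
✓`gibbsK_real_event_le_sum_footprint` (crude Prop. 1 iterated; `0 ≤ θ ≤ 2`, the event being empty beyond `2`) with each fine term bounded by the
level-0 UNIFORM tail ✓`ExpMomentSU2UniformT3.exists_gibbsK_real_dist1_ge_le_uniform` ∘ ✓`SublevelDoubling.oneSite_partitionFunction_doubling_su2_d3`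
(= ★w7 g10's ✓`LevelZeroUniformSU2T3.exists_gibbsK_real_dist1_ge_le`; `β_K ≥ 8`).  No power of `β`, no volume, no `K`.
[cite: Balaban1985Averaging, Prop. 1 (51) p.26; Balaban1985UV3, (71) p.273] -/
theorem gibbsK_real_dist1_iter_ge_le_uniform :
    ∃ A : ℝ, ∀ (F : T3Family) (γ : ℝ), 0 < γ → γ ≤ 1 / 8 → ∀ (K j : ℕ), j ≤ K → ∀ (θ : ℝ), 0 ≤ θ →
      ∀ p : Plaq (F.P K) j,
        (gibbsK F ℰp γ K).real {U : GaugeField (F.P K) 0 (Matrix.specialUnitaryGroup (Fin 2) ℂ) |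
            θ ≤ GaugeGroup.dist1 (GaugeField.plaqHol (Averaging.iter (fun _ => BlockAveraging.blockAvg ℰp) j U) p)} ≤
          (81 * (F.L : ℝ) ^ 3) ^ j * Real.exp A *
            Real.exp (-((F.scheme ℰp γ).β K * θ ^ 2 / (8 * ((151 * (F.L : ℝ) ^ 2) ^ j) ^ 2))) := by
  obtain ⟨A, hA⟩ := exists_gibbsK_real_dist1_ge_le_uniform oneSite_partitionFunction_doubling_su2_d3
  refine ⟨A, fun F γ hγ hγ8 K j hjK θ hθ p => ?_⟩
  haveI := isProbabilityMeasure_gibbsK F ℰp hγ.le K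
  have hβ8 := eight_le_scheme_β F hγ hγ8 K
  set μ := gibbsK F ℰp γ K with hμ
  set βK : ℝ := (F.scheme ℰp γ).β K with hβK
  set Λj : ℝ := (151 * (F.L : ℝ) ^ 2) ^ j with hΛj
  have hΛj0 : 0 < Λj := pow_pos (lam_pos F) j
  have hRHS0 : 0 ≤ (81 * (F.L : ℝ) ^ 3) ^ j * Real.exp A * Real.exp (-(βK * θ ^ 2 / (8 * Λj ^ 2))) := by positivity
  -- beyond `θ = 2` the event is empty
  by_cases hθ2 : 2 < θ
  · have hempty : {U : GaugeField (F.P K) 0 (Matrix.specialUnitaryGroup (Fin 2) ℂ) |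
        θ ≤ GaugeGroup.dist1 (GaugeField.plaqHol (Averaging.iter (fun _ => BlockAveraging.blockAvg ℰp) j U) p)} = ∅ := by
      ext U
      simp only [Set.mem_setOf_eq, Set.mem_empty_iff_false, iff_false, not_le]
      exact (dist1_le_two_specialUnitaryGroup _).trans_lt hθ2
    rw [hempty, measureReal_empty]
    exact hRHS0
  rw [not_lt] at hθ2
  -- the footprint covering
  obtain ⟨T, hTcard, hTbound⟩ := gibbsK_real_event_le_sum_footprint F hγ.le hjK hθ hθ2 p
  refine hTbound.trans ?_
  -- each fine term, prefactor-free
  have ha0 : 0 ≤ θ / Λj := div_nonneg hθ hΛj0.le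
  have hterm : ∀ q : Plaq (F.P K) 0,
      μ.real {U : GaugeField (F.P K) 0 (Matrix.specialUnitaryGroup (Fin 2) ℂ) | θ / Λj ≤ GaugeGroup.dist1 (GaugeField.plaqHol U q)} ≤
        Real.exp A * Real.exp (-(βK * θ ^ 2 / (8 * Λj ^ 2))) := by
    intro q
    have h := hA F ℰp γ K hβ8 (θ / Λj) ha0 q
    have hexp : -(1 / 2 * (βK / 2) * (θ / Λj) ^ 2 / 2) = -(βK * θ ^ 2 / (8 * Λj ^ 2)) := by
      field_simp
      ring
    rw [hexp] at h
    exact h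
  have hsum : ∑ q ∈ T, μ.real {U : GaugeField (F.P K) 0 (Matrix.specialUnitaryGroup (Fin 2) ℂ) |
        θ / Λj ≤ GaugeGroup.dist1 (GaugeField.plaqHol U q)} ≤
      T.card * (Real.exp A * Real.exp (-(βK * θ ^ 2 / (8 * Λj ^ 2)))) := by
    have h := Finset.sum_le_sum fun q (_ : q ∈ T) => hterm q
    rwa [Finset.sum_const, nsmul_eq_mul] at h
  refine hsum.trans ?_
  have h0 : 0 ≤ Real.exp A * Real.exp (-(βK * θ ^ 2 / (8 * Λj ^ 2))) := by positivity
  calc (T.card : ℝ) * (Real.exp A * Real.exp (-(βK * θ ^ 2 / (8 * Λj ^ 2))))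
      ≤ (81 * (F.L : ℝ) ^ 3) ^ j * (Real.exp A * Real.exp (-(βK * θ ^ 2 / (8 * Λj ^ 2)))) :=
        mul_le_mul_of_nonneg_right hTcard h0
    _ = (81 * (F.L : ℝ) ^ 3) ^ j * Real.exp A * Real.exp (-(βK * θ ^ 2 / (8 * Λj ^ 2))) := by ring

/-! ## §2 Window letters: a Gaussian tail at the natural scale `g_{K−j}` -/

/-- **THE WINDOW FORM**: with the same absolute `A`, for every `F`, `0 < γ ≤ 1∕8`, `j ≤ K`, `t ≥ 0` and `a ∈ Plaq(T^{(j)})`: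
`Gibbs_K{t·g_{K−j} ≤ |Ū^{j}(∂a) − 1|} ≤ (81L³)^j · e^{A} · exp(−t²·L^j∕(8·((151L²)^j)²))` — Gaussian in `t`, constants `(L, j)` only.
[cite: Balaban1985Averaging, Prop. 1 (51) p.26; Balaban1985UV3, (3) p.256 and (71) p.273] -/
theorem gibbsK_real_window_ge_le_uniform :
    ∃ A : ℝ, ∀ (F : T3Family) (γ : ℝ), 0 < γ → γ ≤ 1 / 8 → ∀ (K j : ℕ), j ≤ K → ∀ (t : ℝ), 0 ≤ t →
      ∀ a : Plaq (F.P K) j,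
        (gibbsK F ℰp γ K).real {U : GaugeField (F.P K) 0 (Matrix.specialUnitaryGroup (Fin 2) ℂ) |
            t * Real.sqrt (γ * ((F.L : ℝ)⁻¹) ^ (K - j)) ≤
              GaugeGroup.dist1 (GaugeField.plaqHol
                (Averaging.iter (fun i' => BlockAveraging.blockAvg (P := F.P K) (j := i') ℰp) j U) a)} ≤
          (81 * (F.L : ℝ) ^ 3) ^ j * Real.exp A *
            Real.exp (-(t ^ 2 * (F.L : ℝ) ^ j / (8 * ((151 * (F.L : ℝ) ^ 2) ^ j) ^ 2))) := by
  obtain ⟨A, hA⟩ := gibbsK_real_dist1_iter_ge_le_uniform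
  refine ⟨A, fun F γ hγ hγ8 K j hjK t ht a => ?_⟩
  have hg : 0 ≤ Real.sqrt (γ * ((F.L : ℝ)⁻¹) ^ (K - j)) := Real.sqrt_nonneg _
  have h := hA F γ hγ hγ8 K j hjK (t * Real.sqrt (γ * ((F.L : ℝ)⁻¹) ^ (K - j))) (mul_nonneg ht hg) a
  have hexp : (F.scheme ℰp γ).β K * (t * Real.sqrt (γ * ((F.L : ℝ)⁻¹) ^ (K - j))) ^ 2 = t ^ 2 * (F.L : ℝ) ^ j := by
    rw [mul_pow, mul_left_comm, beta_mul_coupling_sq F hγ hjK, mul_comm]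
  rw [hexp] at h
  exact h

/-- Completing the square: `C·e^{−c n²} ≤ C·e^{1∕(4c)}·e^{−n}` (`c > 0`, `C ≥ 0`). [folklore] -/
theorem gauss_le_linExp {C c : ℝ} (hC : 0 ≤ C) (hc : 0 < c) (n : ℝ) :
    C * Real.exp (-(c * n ^ 2)) ≤ C * Real.exp (1 / (4 * c)) * Real.exp (-(1 * n)) := by
  rw [mul_assoc, ← Real.exp_add]
  refine mul_le_mul_of_nonneg_left (Real.exp_le_exp.mpr ?_) hC
  have h4c : 0 < 4 * c := by positivity
  have hsq : 0 ≤ c * (n - 1 / (2 * c)) ^ 2 := by positivity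
  have hid : c * (n - 1 / (2 * c)) ^ 2 = c * n ^ 2 - n + 1 / (4 * c) := by
    field_simp
    ring
  linarith [hsq, hid]

end Summit.QuantumFields.YangMills.Theorems.LocalInsertion.BoundedHeightTailUniform

end
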